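import Mathlib
import Summits.MatrixMultiplication.MatrixMultiplication.Theorems.SoloBlindKraftDecomposition
import Summits.MatrixMultiplication.MatrixMultiplication.Theorems.SoloBlindOlsonElement

set_option linter.dupNamespace false

/-!
# Solo-blind seat (MatrixMultiplication), s76 — Olson's bound for `𝔽₃^r` and the OLSON–BERMAN CONGRUENCE
(HOME `paper/KraftK3.md` §7.17, K3.17.3; CLAIMS c798).  Part 2 of 2 (part 1: `SoloBlindOlsonElement`).

Door I1⁗ / the Kraft conjecture `(K₃)`: for a zero-sum-free sequence `a : Fin m → 𝔽₃^r` and `τ ∈ 𝔽₃^r`,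
`K(τ) = Σ_{T : a_T = τ} 2^{-|T|} ≤ 1`.  This file puts the ARITHMETIC face of `(K₃)` into the kernel.
* `soloBlindOB_coeff` : the coefficient of Olson's element `∏ (1 - T (a k)) ∈ 𝔽₃[𝔽₃^r]` at `τ` is the
  SIGNED REPRESENTATION COUNT `c_a(τ) = Σ_{T ⊆ [m], a_T = τ} (-1)^{|T|} ∈ 𝔽₃`
  (`soloBlindOBSignedCount`), and `c_a(0) = 1` when `a` is zero-sum free (`soloBlindOB_signedCount_zero`).
* `soloBlindOB_olson_bound` : OLSON'S THEOREM for `𝔽₃^r`: a zero-sum-free sequence has length `m ≤ 2r`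
  (the Davenport constant of `C₃^r` is at most `2r + 1`).
* `soloBlindOB_signedCount_eq_one` : the OLSON–BERMAN CONGRUENCE at maximal length: if `m = 2r` then
  `c_a(τ) = 1` for EVERY `τ`.
* `soloBlindOB_kraft_congruence`, `soloBlindOB_kraft_congruence_rat` : consequently
  `3 ∣ Σ_{a_T = τ} 2^{m-|T|} - 1`, i.e. `2^m · K(τ) ≡ 1 (mod 3)` for the Kraft mass `soloBlindKraft` of
  `SoloBlindKraftDecomposition` — the law observed on all `1.07·10¹⁰` fibres of the rank-`≤ 5` censuses
  (Kraft values `1, 13/16, 29/32, 5/8, 49/64 = 1 - 3j·2^{-W}` on maximal sequences).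
No `sorry`, standard axioms.
-/

namespace Summit.MatrixMultiplication.MatrixMultiplication.Theorems

open Finset

section OlsonBerman

variable {r : ℕ}

/-- The signed representation count `c_a(τ) = Σ_{T ⊆ [m], a_T = τ} (-1)^{|T|} ∈ 𝔽₃`. -/
def soloBlindOBSignedCount {m : ℕ} (a : Fin m → Fin r → ZMod 3) (τ : Fin r → ZMod 3) : ZMod 3 :=
  ∑ T ∈ (univ : Finset (Fin m)).powerset, if ∑ k ∈ T, a k = τ then (-1 : ZMod 3) ^ T.card else 0

/-- A signed product of basis elements. -/
theorem soloBlindOB_prod_neg_T {m : ℕ} (a : Fin m → Fin r → ZMod 3) (T : Finset (Fin m)) :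
    ∏ k ∈ T, (-soloBlindOBT r (a k)) = ((-1 : ZMod 3) ^ T.card) • soloBlindOBT r (∑ k ∈ T, a k) := by
  classical
  induction T using Finset.induction_on with
  | empty => simp [soloBlindOB_T_zero]
  | insert j T hj ih =>
      rw [prod_insert hj, sum_insert hj, ih, card_insert_of_notMem hj, pow_succ, soloBlindOB_T_add,
        mul_smul_comm, neg_mul, smul_neg, mul_neg_one, neg_smul]

/-- Olson's element expanded over subsets: `∏ (1 - [a k]) = Σ_T (-1)^{|T|} [a_T]`. -/
theorem soloBlindOB_prod_one_sub_T {m : ℕ} (a : Fin m → Fin r → ZMod 3) :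
    ∏ k, (1 - soloBlindOBT r (a k))
      = ∑ T ∈ (univ : Finset (Fin m)).powerset,
          ((-1 : ZMod 3) ^ T.card) • soloBlindOBT r (∑ k ∈ T, a k) := by
  classical
  have e : ∀ k, (1 : SoloBlindOBAlg r) - soloBlindOBT r (a k) = -soloBlindOBT r (a k) + 1 :=
    fun k => (neg_add_eq_sub _ _).symm
  simp_rw [e]
  rw [Finset.prod_add]
  refine Finset.sum_congr rfl fun T _ => ?_
  rw [prod_const_one, mul_one, soloBlindOB_prod_neg_T]

/-- COEFFICIENT EXTRACTION: the coefficient of Olson's element at `τ` is the signed count `c_a(τ)`. -/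
theorem soloBlindOB_coeff {m : ℕ} (a : Fin m → Fin r → ZMod 3) (τ : Fin r → ZMod 3) :
    (∏ k, (1 - soloBlindOBT r (a k))).coeff (Multiplicative.ofAdd τ) = soloBlindOBSignedCount a τ := by
  classical
  rw [soloBlindOB_prod_one_sub_T, MonoidAlgebra.coeff_sum, Finsupp.finsetSum_apply]
  unfold soloBlindOBSignedCount
  refine Finset.sum_congr rfl fun T _ => ?_
  rw [MonoidAlgebra.coeff_smul_apply, soloBlindOB_T_apply, smul_eq_mul, mul_ite, mul_one, mul_zero]

/-- For a zero-sum-free sequence only the empty sub-sum represents `0`: `c_a(0) = 1`. -/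
theorem soloBlindOB_signedCount_zero {m : ℕ} (a : Fin m → Fin r → ZMod 3)
    (hz : ∀ T : Finset (Fin m), T.Nonempty → ∑ k ∈ T, a k ≠ 0) :
    soloBlindOBSignedCount a 0 = 1 := by
  classical
  unfold soloBlindOBSignedCount
  rw [Finset.sum_eq_single ∅]
  · simp
  · intro T _ hT
    rw [if_neg (hz T (nonempty_iff_ne_empty.2 hT))]
  · intro h; exact absurd (empty_mem_powerset _) h

/-- OLSON'S THEOREM for `𝔽₃^r`: a zero-sum-free sequence in `𝔽₃^r` has length at most `2r`
(the Davenport constant of `C₃^r` is at most `2r + 1`). -/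
theorem soloBlindOB_olson_bound {m : ℕ} (a : Fin m → Fin r → ZMod 3)
    (hz : ∀ T : Finset (Fin m), T.Nonempty → ∑ k ∈ T, a k ≠ 0) : m ≤ 2 * r := by
  by_contra hlt
  have hm : 2 * r + 1 ≤ m := by omega
  have h0 := soloBlindOB_coeff a 0
  rw [soloBlindOB_olson_prod_eq_zero hm a, soloBlindOB_signedCount_zero a hz] at h0
  simp at h0

/-- THE OLSON–BERMAN CONGRUENCE at maximal length: for a zero-sum-free sequence of length `2r` in
`𝔽₃^r`, the signed representation count is `1` at EVERY point: `Σ_{a_T = τ} (-1)^{|T|} ≡ 1 (mod 3)`. -/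
theorem soloBlindOB_signedCount_eq_one {m : ℕ} (a : Fin m → Fin r → ZMod 3)
    (hz : ∀ T : Finset (Fin m), T.Nonempty → ∑ k ∈ T, a k ≠ 0) (hm : m = 2 * r)
    (τ : Fin r → ZMod 3) : soloBlindOBSignedCount a τ = 1 := by
  obtain ⟨c, hc⟩ := soloBlindOB_olson_prod_eq_smul hm a
  have h0 := soloBlindOB_coeff a 0
  rw [hc, MonoidAlgebra.coeff_smul_apply, soloBlindOB_norm_apply, soloBlindOB_signedCount_zero a hz,
    smul_eq_mul, mul_one] at h0
  have hτ := soloBlindOB_coeff a τ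
  rw [hc, MonoidAlgebra.coeff_smul_apply, soloBlindOB_norm_apply, smul_eq_mul, mul_one, h0] at hτ
  exact hτ.symm

/-- In `𝔽₃`, `2^(m-k) = (-1)^k` when `m` is even and `k ≤ m`. -/
theorem soloBlindOB_two_pow_sub {m k : ℕ} (hm : Even m) (hk : k ≤ m) :
    (2 : ZMod 3) ^ (m - k) = (-1 : ZMod 3) ^ k := by
  have h2 : (2 : ZMod 3) = -1 := by decide
  rw [h2]
  have hsq : ((-1 : ZMod 3) ^ k) * (-1 : ZMod 3) ^ k = 1 := by
    rw [← pow_add, ← two_mul, pow_mul]; norm_num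
  have hm1 : (-1 : ZMod 3) ^ m = 1 := by
    obtain ⟨j, rfl⟩ := hm; rw [← two_mul, pow_mul]; norm_num
  have : (-1 : ZMod 3) ^ (m - k) * (-1 : ZMod 3) ^ k = (-1 : ZMod 3) ^ k * (-1 : ZMod 3) ^ k := by
    rw [← pow_add, Nat.sub_add_cancel hk, hm1, hsq]
  have hu : IsUnit ((-1 : ZMod 3) ^ k) := (isUnit_one.neg).pow k
  exact hu.mul_left_injective this

/-- KRAFT CONGRUENCE (integer form): for a zero-sum-free sequence of length `m = 2r` in `𝔽₃^r` and
every `τ`, `3 ∣ Σ_{a_T = τ} 2^{m - |T|} - 1`, i.e. `2^m · K(τ) ≡ 1 (mod 3)`. -/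
theorem soloBlindOB_kraft_congruence {m : ℕ} (a : Fin m → Fin r → ZMod 3)
    (hz : ∀ T : Finset (Fin m), T.Nonempty → ∑ k ∈ T, a k ≠ 0) (hm : m = 2 * r)
    (τ : Fin r → ZMod 3) :
    (3 : ℤ) ∣ (∑ T ∈ (univ : Finset (Fin m)).powerset with ∑ k ∈ T, a k = τ,
        (2 : ℤ) ^ (m - T.card)) - 1 := by
  classical
  have hcong := soloBlindOB_signedCount_eq_one a hz hm τ
  unfold soloBlindOBSignedCount at hcong
  rw [← Finset.sum_filter] at hcong
  have hcast : (((∑ T ∈ (univ : Finset (Fin m)).powerset with ∑ k ∈ T, a k = τ,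
        (2 : ℤ) ^ (m - T.card)) - 1 : ℤ) : ZMod 3) = 0 := by
    push_cast
    rw [sub_eq_zero]
    rw [← hcong]
    refine Finset.sum_congr rfl fun T hT => ?_
    have hTm : T.card ≤ m := by
      have := card_le_card (mem_powerset.1 (mem_filter.1 hT).1)
      simpa using this
    have hev : Even m := ⟨r, by omega⟩
    exact soloBlindOB_two_pow_sub hev hTm
  exact (ZMod.intCast_zmod_eq_zero_iff_dvd _ 3).1 hcast

/-- KRAFT CONGRUENCE for the Kraft mass `K = soloBlindKraft` of `SoloBlindKraftDecomposition`:
for a zero-sum-free `a` of length `m = 2r` in `𝔽₃^r`, `2^m · K(τ) = 3z + 1` for some integer `z`: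
the Kraft sum is `≡ 1 (mod 3)` in `ℤ[1/2]` (so a counterexample to `(K₃)` on a maximal sequence must
overshoot `1` by a positive multiple of `3·2^{-m}`). -/
theorem soloBlindOB_kraft_congruence_rat {m : ℕ} (a : Fin m → Fin r → ZMod 3)
    (hz : ∀ T : Finset (Fin m), T.Nonempty → ∑ k ∈ T, a k ≠ 0) (hm : m = 2 * r)
    (τ : Fin r → ZMod 3) :
    ∃ z : ℤ, (2 : ℚ) ^ m * soloBlindKraft univ a τ = 3 * z + 1 := by
  classical
  obtain ⟨z, hz3⟩ := soloBlindOB_kraft_congruence a hz hm τ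
  refine ⟨z, ?_⟩
  have hint : (2 : ℚ) ^ m * soloBlindKraft univ a τ
      = ((∑ T ∈ (univ : Finset (Fin m)).powerset with ∑ k ∈ T, a k = τ,
          (2 : ℤ) ^ (m - T.card) : ℤ) : ℚ) := by
    unfold soloBlindKraft
    rw [Finset.mul_sum]
    push_cast
    refine Finset.sum_congr (by congr!) fun T hT => ?_
    have hTm : T.card ≤ m := by
      have := card_le_card (mem_powerset.1 (mem_filter.1 hT).1)
      simpa using this
    have e2 : (2 : ℚ) ^ m = 2 ^ (m - T.card) * 2 ^ T.card := by
      rw [← pow_add, Nat.sub_add_cancel hTm]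
    rw [e2, mul_assoc, ← mul_pow]
    norm_num
  rw [hint]
  have : (∑ T ∈ (univ : Finset (Fin m)).powerset with ∑ k ∈ T, a k = τ, (2 : ℤ) ^ (m - T.card) : ℤ)
      = 3 * z + 1 := by omega
  rw [this]; push_cast; ring

end OlsonBerman

end Summit.MatrixMultiplication.MatrixMultiplication.Theorems
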